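import Literature.AlgebraicGeometry.Resolution.Lipman1969RegularBaseChangeHolds
import Literature.AlgebraicGeometry.Resolution.Lipman1969NormalBaseChange
import Literature.AlgebraicGeometry.Resolution.Lipman1969RationalSingularityBaseChange
import HarnessLib

/-!
# Lipman 1969, Proposition (16.5), forward direction — UNCONDITIONAL
# ("A normal ⇒ B normal", "A rational ⇒ B rational" along flat local base change)

Topic: `Literature/AlgebraicGeometry/Resolution`.  The two forward halves of the named fact
`Lipman1969_16_5` (`Resolution/Lipman1969FormallySmoothBaseChange`; J. Lipman, Publ. Math. IHÉS 36
(1969), Prop. (16.5), p. 235) were proved CONDITIONALLY on Lemma (16.1) (ii) in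
`Resolution/Lipman1969NormalBaseChange` (`Lipman1969_16_5_normal_mp_of_16_1_ii`, half (N)) and
`Resolution/Lipman1969RationalSingularityBaseChange` (`Lipman1969_16_5_rational_mp_of_16_1_ii`,
half (R)); Lemma (16.1) (ii) is now the theorem `Lipman1969_16_1_ii_holds`
(`Resolution/Lipman1969RegularBaseChangeHolds`).  This file records the resulting UNCONDITIONAL
theorems, with the binders of `Lipman1969_16_5` verbatim:

* `Lipman1969_16_5_normal_mp` — `A` normal ⇒ `B` normal;
* `Lipman1969_16_5_rational_mp` — `A` normal with a rational singularity ⇒ `B` has a rational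
  singularity;
* `Lipman1969_16_5_forward` — both, as the single conjunction
  `((IsDomain A ∧ IsIntegrallyClosed A) → (IsDomain B ∧ IsIntegrallyClosed B)) ∧
   ((IsDomain A ∧ IsIntegrallyClosed A) → HasRationalSingularity A → HasRationalSingularity B)`,
  i.e. the `.mp` shadow of the conclusion of `Lipman1969_16_5` — the form its consumers destructure
  (`hnorm.mp`, `(hrat _).mp`).

What is NOT here: the converse direction of (16.5) ("B normal ⇒ A normal", "B rational ⇒ A
rational", Lipman pp. 235–236, by descending quadratic transformations), so the iff-valued named
fact `Lipman1969_16_5` itself is NOT discharged by this file.  No new definitions; no named facts;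
no summit statement is proved here; resolution of singularities in dimension `≥ 4` /
characteristic `p` is NOT proved here.

## References

* J. Lipman, *Rational singularities, with applications to algebraic surfaces and unique
  factorization*, Publ. Math. IHÉS 36 (1969) 195–279: Prop. (16.5), p. 235; Lemma (16.1) (ii),
  p. 231. [Lipman1969]
-/

noncomputable section

open CategoryTheory CategoryTheory.Limits AlgebraicGeometry TopologicalSpace IsLocalRing

universe u

namespace Literature.AlgebraicGeometry.Resolution

/-- **Lipman 1969, Proposition (16.5), "`A` normal ⇒ `B` normal"** (unconditional): for `A`, `B`
Noetherian local, `A → B` local and flat with `𝔪_A B = 𝔪_B` and `κ(B)/κ(A)` separable algebraic,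
`A` reduced, `dim A = dim B = 2`, `Spec A` admitting a desingularization: if `A` is an integrally
closed domain then so is `B` (half (N) `Lipman1969_16_5_normal_mp_of_16_1_ii` applied to
`Lipman1969_16_1_ii_holds`). [cite: Lipman1969, Proposition (16.5) (p. 235)] -/
theorem Lipman1969_16_5_normal_mp :
    ∀ (A B : Type u) [CommRing A] [CommRing B] [IsNoetherianRing A] [IsNoetherianRing B]
    [IsLocalRing A] [IsLocalRing B] [Algebra A B] [IsLocalHom (algebraMap A B)] [Module.Flat A B],
    IsReduced A →
    (maximalIdeal A).map (algebraMap A B) = maximalIdeal B →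
    Algebra.IsSeparable (ResidueField A) (ResidueField B) →
    ringKrullDim A = 2 → ringKrullDim B = 2 →
    (∃ (Y : Scheme.{u}) (g : Y ⟶ Spec (.of A)), IsResolution g) →
      (IsDomain A ∧ IsIntegrallyClosed A) → (IsDomain B ∧ IsIntegrallyClosed B) :=
  Lipman1969_16_5_normal_mp_of_16_1_ii Lipman1969_16_1_ii_holds

/-- **Lipman 1969, Proposition (16.5), "`A` rational ⇒ `B` rational"** (unconditional): in the
same setting, if `A` is normal and has a rational singularity then `B` has a rational singularity
(half (R) `Lipman1969_16_5_rational_mp_of_16_1_ii` applied to `Lipman1969_16_1_ii_holds`; the proof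
is Lipman's: base-change a desingularization with `H¹ = 0` and use flat base change of `H¹`).
[cite: Lipman1969, Proposition (16.5) (p. 235)] -/
theorem Lipman1969_16_5_rational_mp :
    ∀ (A B : Type u) [CommRing A] [CommRing B] [IsNoetherianRing A] [IsNoetherianRing B]
    [IsLocalRing A] [IsLocalRing B] [Algebra A B] [IsLocalHom (algebraMap A B)] [Module.Flat A B],
    IsReduced A →
    (maximalIdeal A).map (algebraMap A B) = maximalIdeal B →
    Algebra.IsSeparable (ResidueField A) (ResidueField B) →
    ringKrullDim A = 2 → ringKrullDim B = 2 →
    (∃ (Y : Scheme.{u}) (g : Y ⟶ Spec (.of A)), IsResolution g) →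
      (IsDomain A ∧ IsIntegrallyClosed A) → HasRationalSingularity A → HasRationalSingularity B :=
  Lipman1969_16_5_rational_mp_of_16_1_ii Lipman1969_16_1_ii_holds

/-- **Lipman 1969, Proposition (16.5), forward direction** (unconditional), stated as the `.mp`
shadow of the conclusion of the named fact `Lipman1969_16_5` (same binders):
`((A normal → B normal) ∧ (A normal → (A rational → B rational)))`.  The converse implications of
(16.5) are not proved here. [cite: Lipman1969, Proposition (16.5) (p. 235)] -/
theorem Lipman1969_16_5_forward :
    ∀ (A B : Type u) [CommRing A] [CommRing B] [IsNoetherianRing A] [IsNoetherianRing B]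
    [IsLocalRing A] [IsLocalRing B] [Algebra A B] [IsLocalHom (algebraMap A B)] [Module.Flat A B],
    IsReduced A →
    (maximalIdeal A).map (algebraMap A B) = maximalIdeal B →
    Algebra.IsSeparable (ResidueField A) (ResidueField B) →
    ringKrullDim A = 2 → ringKrullDim B = 2 →
    (∃ (Y : Scheme.{u}) (g : Y ⟶ Spec (.of A)), IsResolution g) →
      ((IsDomain A ∧ IsIntegrallyClosed A) → (IsDomain B ∧ IsIntegrallyClosed B)) ∧
        ((IsDomain A ∧ IsIntegrallyClosed A) →
          (HasRationalSingularity A → HasRationalSingularity B)) :=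
  fun A B _ _ _ _ _ _ _ _ _ hred hmax hsep hdA hdB hY =>
    ⟨Lipman1969_16_5_normal_mp A B hred hmax hsep hdA hdB hY,
      Lipman1969_16_5_rational_mp A B hred hmax hsep hdA hdB hY⟩

end Literature.AlgebraicGeometry.Resolution

end
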